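import Literature.InformationTheory.QuantumCodes.WeightEnumeratorBounds
import HarnessLib

/-!
# LP-infeasibility certificates for Rains's linear program for general quantum codes `((n,K,d))` (Farkas form)

Venture QEC (cell `qec`, LADDER-QEC rung X1 «LP/shadow upper bounds per (n,k) — make "optimal" precise — for ALL
quantum codes, additive or not»; PARTITION row 06). `Literature/InformationTheory/QuantumCodes/WeightEnumeratorBounds.lean`
types Rains's system [Rains1999Shadow, Thm. 10] as `RainsLPFeasible n K d` (`A_0 = K²`; `A_i ≥ 0`; `A_i = K B_i`
for `i < d`; `A_i ≤ K B_i` for `d ≤ i ≤ n`; `S_i ≥ 0`; `B = rainsDual n A`, `S = rainsShadow n A`) and the theorem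
«the projection onto an `((n,K,d))` makes it feasible» as the NAMED FACT `Rains1999_LPBound` (being proved in the
tree by qec-type-03, operator-valued enumerators). This file is the census side, exactly parallel to
`LPCertificate.lean` (CRSS's additive system): a checkable certificate that Rains's system is INfeasible at `(n,K,d)`,
so that «no `((n,K,d))` quantum code of any kind» can be printed next to a census row — conditional on the named fact
until it is discharged, unconditional afterwards.

HONEST FRAMING: `not_rainsLPFeasible_of_check` is UNCONDITIONAL weak duality (a checked certificate refutes the typed
system); `no_codeProjection_of_check` is CONDITIONAL on `Rains1999_LPBound` (trust base = that name, D-0014).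
Nothing here is a distance of a code. For `K = 1` Rains's system is vacuous without purity (`Rains1999_LPBound_pure`),
not handled here. Certificates are exact rationals and `RainsCert.check` is a pure Boolean function: an instance by
`decide`/`decide +kernel` is tier KERNEL.

The certificate: multipliers `u` (of `A_0 = K²`), `y_j` (of `K B_j − A_j`, written ×`2ⁿ` as
`K Σ_r P_j(r,n) A_r − 2ⁿ A_j`: `= 0` for `j < d`, `≥ 0` for `j ≥ d`, so `y_j ≥ 0` is required only for `j ≥ d`), `s_j ≥ 0`
(of `2ⁿ S_j = Σ_r (−1)^r P_j(r,n) A_r ≥ 0`). Validity: `κ_i := u·[i=0] + Σ_j y_j (K P_j(i,n) − 2ⁿ[j=i]) +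
Σ_j s_j (−1)^i P_j(i,n) ≤ 0` for `0 ≤ i ≤ n` and `u > 0`; then feasibility would give
`0 ≥ Σ_i κ_i A_i = u K² + (nonnegative) > 0` (using `K ≥ 1`). A worked instance closes the file:
`(n,K,d) = (5,2,4)` — «no `((5,2,4))`», the five-qubit code `((5,2,3))` being LP-extremal among ALL codes.

References: E. M. Rains, *Quantum shadow enumerators*, IEEE Trans. Inform. Theory 45 (1999) 2361–2366, Thm. 10 and
the table discussion after it («the LP bound for general QECCs … agrees with the bound for additive codes … except
for ten entries») [Rains1999Shadow]; F. J. MacWilliams, N. J. A. Sloane, *The Theory of Error-Correcting Codes*,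
Ch. 17 §4 Thm. 20 (dual-feasible vectors as certificates) [MacWilliamsSloane1977].
-/

namespace Summit.Ventures.QEC.Census

open Finset Literature.InformationTheory.QuantumCodes

/-! ### Certificates -/

/-- A Farkas-type **infeasibility certificate** for Rains's system at length `n`: rational multipliers `u` (of
`A_0 = K²`), `y = [y_0,…,y_n]` (of `K·Σ_r P_j(r,n) A_r − 2ⁿ A_j`, `= 0` for `j < d`, `≥ 0` for `j ≥ d`),
`s = [s_0,…,s_n]` (of `Σ_r (−1)^r P_j(r,n) A_r ≥ 0`); missing list entries read as `0`. Column: definition (ours).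
[cite: MacWilliamsSloane1977, Ch. 17 §4 Thm. 20 (dual-feasible vectors as certificates)] -/
structure RainsCert where
  /-- multiplier of `A_0 = K²` -/
  u : ℚ
  /-- multipliers of the MacWilliams constraints `A_j = K B_j` / `A_j ≤ K B_j` -/
  y : List ℚ
  /-- multipliers of the shadow constraints `S_j ≥ 0` -/
  s : List ℚ

namespace RainsCert

/-- `y_j` (zero beyond the list). [cite: MacWilliamsSloane1977, Ch. 17 §4 Thm. 20] -/
def yAt (c : RainsCert) (j : ℕ) : ℚ := c.y.getD j 0

/-- `s_j` (zero beyond the list). [cite: MacWilliamsSloane1977, Ch. 17 §4 Thm. 20] -/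
def sAt (c : RainsCert) (j : ℕ) : ℚ := c.s.getD j 0

/-- The coefficient `κ_i` of `A_i` in the combined functional of the certificate:
`u·[i=0] + Σ_j y_j (K P_j(i,n) − 2ⁿ [j=i]) + Σ_j s_j (−1)^i P_j(i,n)`. Column: definition (ours).
[cite: MacWilliamsSloane1977, Ch. 17 §4 Thm. 20] -/
def kappa (c : RainsCert) (n K : ℕ) (i : ℕ) : ℚ :=
  (if i = 0 then c.u else 0) +
    ∑ j ∈ range (n + 1), c.yAt j * ((K : ℚ) * (krawtchouk4 n j i : ℚ) - if j = i then 2 ^ n else 0) +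
    ∑ j ∈ range (n + 1), c.sAt j * ((-1 : ℚ) ^ i * (krawtchouk4 n j i : ℚ))

/-- **The certificate checker** (pure, `decide`-able): `u > 0`, `y_j ≥ 0` for `d ≤ j ≤ n`, `s_j ≥ 0`, and
`κ_i ≤ 0` for `0 ≤ i ≤ n`. Column: definition (ours). [cite: MacWilliamsSloane1977, Ch. 17 §4 Thm. 20] -/
def check (c : RainsCert) (n K d : ℕ) : Bool :=
  decide (0 < c.u) &&
  ((List.range (n + 1)).all fun j => !(decide (d ≤ j)) || decide (0 ≤ c.yAt j)) &&
  ((List.range (n + 1)).all fun j => decide (0 ≤ c.sAt j)) &&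
  ((List.range (n + 1)).all fun i => decide (c.kappa n K i ≤ 0))

/-- Unpacking a successful check. [cite: MacWilliamsSloane1977, Ch. 17 §4 Thm. 20] -/
theorem check_spec {c : RainsCert} {n K d : ℕ} (h : c.check n K d = true) :
    0 < c.u ∧ (∀ j ∈ range (n + 1), d ≤ j → 0 ≤ c.yAt j) ∧ (∀ j ∈ range (n + 1), 0 ≤ c.sAt j) ∧
    (∀ i ∈ range (n + 1), c.kappa n K i ≤ 0) := by
  simp only [check, Bool.and_eq_true, List.all_eq_true, Bool.or_eq_true, Bool.not_eq_true',
    decide_eq_false_iff_not, decide_eq_true_eq, List.mem_range] at h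
  obtain ⟨⟨⟨hu, hy⟩, hs⟩, hk⟩ := h
  refine ⟨hu, fun j hj hdj => ?_, fun j hj => hs j (by simpa using hj), fun i hi => hk i (by simpa using hi)⟩
  rcases hy j (by simpa using hj) with h' | h'
  · exact absurd hdj h'
  · exact h'

end RainsCert

/-! ### Weak duality -/

section Soundness

variable {n K d : ℕ}

/-- `2ⁿ · K · B_j = K Σ_r P_j(r,n) A_r`. [cite: Rains1999Shadow, Thm. 10 (definition of B_i)] -/
theorem two_pow_mul_rainsDual (A : ℕ → ℝ) (j : ℕ) :
    (2 : ℝ) ^ n * ((K : ℝ) * rainsDual n A j) = (K : ℝ) * ∑ r ∈ range (n + 1), (krawtchouk4 n j r : ℝ) * A r := by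
  unfold rainsDual
  rw [mul_left_comm, ← mul_assoc ((2 : ℝ) ^ n), mul_one_div_cancel (pow_ne_zero _ two_ne_zero), one_mul]

/-- `2ⁿ · S_j = Σ_r (−1)^r P_j(r,n) A_r`. [cite: Rains1999Shadow, Thm. 10 (definition of S_i)] -/
theorem two_pow_mul_rainsShadow (A : ℕ → ℝ) (j : ℕ) :
    (2 : ℝ) ^ n * rainsShadow n A j = ∑ r ∈ range (n + 1), (-1 : ℝ) ^ r * (krawtchouk4 n j r : ℝ) * A r := by
  unfold rainsShadow
  rw [← mul_assoc, mul_one_div_cancel (pow_ne_zero _ two_ne_zero), one_mul]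

/-- **The combined functional, expanded**: `Σ_{i ≤ n} κ_i A_i = u A_0 + Σ_j y_j (K Σ_r P_j(r) A_r − 2ⁿ A_j)
+ Σ_j s_j Σ_r (−1)^r P_j(r) A_r`. [cite: MacWilliamsSloane1977, Ch. 17 §4 Thm. 15 (weak duality computation)] -/
theorem sum_kappa_mul (c : RainsCert) (A : ℕ → ℝ) :
    ∑ i ∈ range (n + 1), (c.kappa n K i : ℝ) * A i =
      (c.u : ℝ) * A 0 +
      ∑ j ∈ range (n + 1), (c.yAt j : ℝ) *
        ((K : ℝ) * ∑ r ∈ range (n + 1), (krawtchouk4 n j r : ℝ) * A r - 2 ^ n * A j) +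
      ∑ j ∈ range (n + 1), (c.sAt j : ℝ) *
        ∑ r ∈ range (n + 1), (-1 : ℝ) ^ r * (krawtchouk4 n j r : ℝ) * A r := by
  have hk : ∀ i, (c.kappa n K i : ℝ) =
      (if i = 0 then (c.u : ℝ) else 0) +
        ∑ j ∈ range (n + 1), (c.yAt j : ℝ) * ((K : ℝ) * (krawtchouk4 n j i : ℝ) - if j = i then 2 ^ n else 0) +
        ∑ j ∈ range (n + 1), (c.sAt j : ℝ) * ((-1 : ℝ) ^ i * (krawtchouk4 n j i : ℝ)) := by
    intro i
    simp only [RainsCert.kappa]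
    push_cast
    congr 1
    · congr 1
      · split_ifs <;> simp
      · refine Finset.sum_congr rfl fun j _ => ?_
        split_ifs <;> simp
  simp_rw [hk]
  have h0 : (0 : ℕ) ∈ range (n + 1) := by simp
  simp only [add_mul, Finset.sum_add_distrib]
  -- (i) the `u` term
  have e0 : ∑ i ∈ range (n + 1), (if i = 0 then (c.u : ℝ) else 0) * A i = (c.u : ℝ) * A 0 := by
    rw [Finset.sum_eq_single_of_mem 0 h0]
    · simp
    · intro i _ hi; simp [hi]
  -- (ii) the `y` double sum
  have e1 : ∑ i ∈ range (n + 1),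
      (∑ j ∈ range (n + 1), (c.yAt j : ℝ) * ((K : ℝ) * (krawtchouk4 n j i : ℝ) - if j = i then 2 ^ n else 0)) * A i =
      ∑ j ∈ range (n + 1), (c.yAt j : ℝ) *
        ((K : ℝ) * ∑ r ∈ range (n + 1), (krawtchouk4 n j r : ℝ) * A r - 2 ^ n * A j) := by
    simp only [Finset.sum_mul]
    rw [Finset.sum_comm]
    refine Finset.sum_congr rfl fun j hj => ?_
    have hδ : (2 : ℝ) ^ n * A j = ∑ x ∈ range (n + 1), (if j = x then (2 : ℝ) ^ n * A x else 0) := by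
      rw [Finset.sum_ite_eq, if_pos hj]
    rw [mul_sub, Finset.mul_sum, Finset.mul_sum, hδ, Finset.mul_sum, ← Finset.sum_sub_distrib]
    refine Finset.sum_congr rfl fun x _ => ?_
    split_ifs <;> ring
  -- (iii) the `s` double sum
  have e2 : ∑ i ∈ range (n + 1),
      (∑ j ∈ range (n + 1), (c.sAt j : ℝ) * ((-1 : ℝ) ^ i * (krawtchouk4 n j i : ℝ))) * A i =
      ∑ j ∈ range (n + 1), (c.sAt j : ℝ) * ∑ r ∈ range (n + 1), (-1 : ℝ) ^ r * (krawtchouk4 n j r : ℝ) * A r := by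
    simp only [Finset.sum_mul]
    rw [Finset.sum_comm]
    refine Finset.sum_congr rfl fun j _ => ?_
    rw [Finset.mul_sum]
    refine Finset.sum_congr rfl fun r _ => ?_
    ring
  rw [e0, e1, e2]

/-- **Weak duality**: a certificate that checks refutes Rains's system (for `K ≥ 1`). UNCONDITIONAL. Column: proved
(ours). [cite: MacWilliamsSloane1977, Ch. 17 §4 Thm. 20 (dual-feasible ⇒ bound; here: ⇒ infeasible); Rains1999Shadow, Thm. 10] -/
theorem not_rainsLPFeasible_of_check (c : RainsCert) (hK : 1 ≤ K) (h : c.check n K d = true) :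
    ¬ RainsLPFeasible n K d := by
  rintro ⟨A, h0, hpos, heq, hle, hsh⟩
  obtain ⟨hu, hy, hs, hκ⟩ := RainsCert.check_spec h
  -- upper bound: Σ κ_i A_i ≤ 0
  have hub : ∑ i ∈ range (n + 1), (c.kappa n K i : ℝ) * A i ≤ 0 :=
    Finset.sum_nonpos fun i hi =>
      mul_nonpos_of_nonpos_of_nonneg (by exact_mod_cast hκ i hi) (hpos i (by simpa [Nat.lt_succ_iff] using hi))
  -- lower bound: the expansion is `u K²` plus nonnegative terms
  have hlb : (c.u : ℝ) * (K : ℝ) ^ 2 ≤ ∑ i ∈ range (n + 1), (c.kappa n K i : ℝ) * A i := by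
    rw [sum_kappa_mul, h0]
    have t1 : 0 ≤ ∑ j ∈ range (n + 1), (c.yAt j : ℝ) *
        ((K : ℝ) * ∑ r ∈ range (n + 1), (krawtchouk4 n j r : ℝ) * A r - 2 ^ n * A j) := by
      refine Finset.sum_nonneg fun j hj => ?_
      have hjn : j ≤ n := by simpa [Nat.lt_succ_iff] using hj
      rw [← two_pow_mul_rainsDual, ← mul_sub]
      rcases lt_or_ge j d with hjd | hjd
      · rw [← heq j hjd]; simp
      · exact mul_nonneg (by exact_mod_cast hy j hj hjd)
          (mul_nonneg (pow_nonneg zero_le_two _) (sub_nonneg.mpr (hle j hjd hjn)))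
    have t2 : 0 ≤ ∑ j ∈ range (n + 1), (c.sAt j : ℝ) *
        ∑ r ∈ range (n + 1), (-1 : ℝ) ^ r * (krawtchouk4 n j r : ℝ) * A r := by
      refine Finset.sum_nonneg fun j hj => ?_
      have hjn : j ≤ n := by simpa [Nat.lt_succ_iff] using hj
      rw [← two_pow_mul_rainsShadow]
      exact mul_nonneg (by exact_mod_cast hs j hj) (mul_nonneg (pow_nonneg zero_le_two _) (hsh j hjn))
    linarith
  have hK' : (1 : ℝ) ≤ (K : ℝ) ^ 2 := by
    have : (1 : ℝ) ≤ K := by exact_mod_cast hK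
    nlinarith
  have hu' : (0 : ℝ) < c.u := by exact_mod_cast hu
  nlinarith

/-- **Certified LP upper bound for ALL quantum codes, conditional on Rains's Theorem 10**: granted the named fact
`Rains1999_LPBound`, a checked certificate shows that no `((n,K,d))` exists — no `2ⁿ`-dimensional-register code
projection `P` of rank `K` detecting all Pauli errors of weight `≤ d − 1` (`IsCodeProjection P K d`, the monotone
reading), additive or not. The trust base is the cited fact. Column: proved (ours), CONDITIONAL.
[cite: Rains1999Shadow, Thm. 10 and the table discussion after it] -/
theorem no_codeProjection_of_check (hLP : Rains1999_LPBound) (c : RainsCert) (hK : 1 ≤ K)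
    (h : c.check n K d = true) (P : Matrix (Fin n → Bool) (Fin n → Bool) ℂ) (hP : IsCodeProjection P K d) : False :=
  not_rainsLPFeasible_of_check c hK h (hLP n K d P hP)

end Soundness

/-! ### A worked instance: no `((5,2,4))` — the five-qubit code is LP-extremal among all quantum codes -/

/-- Certificate for Rains's system at `(n,K,d) = (5,2,4)` (exact rational simplex on the dual system; cell qec,
`run/shared/lean/pub/qec/census/type-06/farkas_rains.py`). Column: data (ours).
[cite: Rains1999Shadow, §3 (table after Thm. 10: n = 5, K = 2)] -/
def rcert_5_2_4 : RainsCert :=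
  ⟨1, [(-1/72), (-1/144), (-1/576), (-1/576), 0, 0], [(1/24), 0, 0, 0, 0, 0]⟩

/-- The certificate checks (kernel evaluation). [cite: Rains1999Shadow, §3 (table after Thm. 10)] -/
theorem check_rcert_5_2_4 : rcert_5_2_4.check 5 2 4 = true := by
  decide +kernel

/-- **Rains's system is infeasible at `(n,K,d) = (5,2,4)`** — unconditional, kernel-checked (it IS feasible at
`(5,2,3)`, the five-qubit code). Column: proved (ours). [cite: Rains1999Shadow, Thm. 10 and §3] -/
theorem not_rainsLPFeasible_5_2_4 : ¬ RainsLPFeasible 5 2 4 :=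
  not_rainsLPFeasible_of_check _ (by norm_num) check_rcert_5_2_4

/-- **No `((5,2,4))` quantum code of any kind — CONDITIONAL on Rains's Theorem 10** (named fact `Rains1999_LPBound`).
Column: proved (ours), conditional. [cite: Rains1999Shadow, Thm. 10 and §3] -/
theorem no_code_5_2_4 (hLP : Rains1999_LPBound) (P : Matrix (Fin 5 → Bool) (Fin 5 → Bool) ℂ)
    (hP : IsCodeProjection P 2 4) : False :=
  no_codeProjection_of_check hLP _ (by norm_num) check_rcert_5_2_4 P hP

/-! ### Pure codes: Rains's system with the purity constraints (`K = 1` / self-dual codes) -/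

namespace RainsCert

/-- **The checker for the PURE system** (`RainsLPFeasiblePure`: additionally `A_i = 0` for `1 ≤ i < d`, whose
multipliers are free): as `check`, except that no sign is required of `κ_i` for `1 ≤ i < d`. Column: definition
(ours). [cite: Rains1999Shadow, Remark after Thm. 10 (pure codes: A_i = 0 for 1 ≤ i < d); MacWilliamsSloane1977, Ch. 17 §4 Thm. 20] -/
def checkPure (c : RainsCert) (n K d : ℕ) : Bool :=
  decide (0 < c.u) &&
  ((List.range (n + 1)).all fun j => !(decide (d ≤ j)) || decide (0 ≤ c.yAt j)) &&
  ((List.range (n + 1)).all fun j => decide (0 ≤ c.sAt j)) &&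
  ((List.range (n + 1)).all fun i => !(decide (i = 0 ∨ d ≤ i)) || decide (c.kappa n K i ≤ 0))

/-- Unpacking a successful pure check. [cite: MacWilliamsSloane1977, Ch. 17 §4 Thm. 20] -/
theorem checkPure_spec {c : RainsCert} {n K d : ℕ} (h : c.checkPure n K d = true) :
    0 < c.u ∧ (∀ j ∈ range (n + 1), d ≤ j → 0 ≤ c.yAt j) ∧ (∀ j ∈ range (n + 1), 0 ≤ c.sAt j) ∧
    (∀ i ∈ range (n + 1), (i = 0 ∨ d ≤ i) → c.kappa n K i ≤ 0) := by
  simp only [checkPure, Bool.and_eq_true, List.all_eq_true, Bool.or_eq_true, Bool.not_eq_true',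
    decide_eq_false_iff_not, decide_eq_true_eq, List.mem_range] at h
  obtain ⟨⟨⟨hu, hy⟩, hs⟩, hk⟩ := h
  refine ⟨hu, fun j hj hdj => ?_, fun j hj => hs j (by simpa using hj), fun i hi hid => ?_⟩
  · rcases hy j (by simpa using hj) with h' | h'
    · exact absurd hdj h'
    · exact h'
  · rcases hk i (by simpa using hi) with h' | h'
    · exact absurd hid h'
    · exact h'

end RainsCert

section SoundnessPure

variable {n K d : ℕ}

/-- **Weak duality for the pure system**: a certificate passing `checkPure` refutes `RainsLPFeasiblePure n K d` (for
`K ≥ 1`): the terms `κ_i A_i` with `1 ≤ i < d` vanish because `A_i = 0`. UNCONDITIONAL. Column: proved (ours).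
[cite: Rains1999Shadow, Thm. 10 with the Remark after it; MacWilliamsSloane1977, Ch. 17 §4 Thm. 20] -/
theorem not_rainsLPFeasiblePure_of_checkPure (c : RainsCert) (hK : 1 ≤ K) (h : c.checkPure n K d = true) :
    ¬ RainsLPFeasiblePure n K d := by
  rintro ⟨A, h0, hpos, hpure, heq, hle, hsh⟩
  obtain ⟨hu, hy, hs, hκ⟩ := RainsCert.checkPure_spec h
  -- upper bound: Σ κ_i A_i ≤ 0 (for `1 ≤ i < d` the term is `κ_i · 0`)
  have hub : ∑ i ∈ range (n + 1), (c.kappa n K i : ℝ) * A i ≤ 0 := by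
    refine Finset.sum_nonpos fun i hi => ?_
    have hin : i ≤ n := by simpa [Nat.lt_succ_iff] using hi
    by_cases hid : i = 0 ∨ d ≤ i
    · exact mul_nonpos_of_nonpos_of_nonneg (by exact_mod_cast hκ i hi hid) (hpos i hin)
    · push Not at hid
      rw [hpure i (Nat.one_le_iff_ne_zero.2 hid.1) hid.2, mul_zero]
  -- lower bound: the expansion is `u K²` plus nonnegative terms
  have hlb : (c.u : ℝ) * (K : ℝ) ^ 2 ≤ ∑ i ∈ range (n + 1), (c.kappa n K i : ℝ) * A i := by
    rw [sum_kappa_mul, h0]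
    have t1 : 0 ≤ ∑ j ∈ range (n + 1), (c.yAt j : ℝ) *
        ((K : ℝ) * ∑ r ∈ range (n + 1), (krawtchouk4 n j r : ℝ) * A r - 2 ^ n * A j) := by
      refine Finset.sum_nonneg fun j hj => ?_
      have hjn : j ≤ n := by simpa [Nat.lt_succ_iff] using hj
      rw [← two_pow_mul_rainsDual, ← mul_sub]
      rcases lt_or_ge j d with hjd | hjd
      · rw [← heq j hjd]; simp
      · exact mul_nonneg (by exact_mod_cast hy j hj hjd)
          (mul_nonneg (pow_nonneg zero_le_two _) (sub_nonneg.mpr (hle j hjd hjn)))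
    have t2 : 0 ≤ ∑ j ∈ range (n + 1), (c.sAt j : ℝ) *
        ∑ r ∈ range (n + 1), (-1 : ℝ) ^ r * (krawtchouk4 n j r : ℝ) * A r := by
      refine Finset.sum_nonneg fun j hj => ?_
      have hjn : j ≤ n := by simpa [Nat.lt_succ_iff] using hj
      rw [← two_pow_mul_rainsShadow]
      exact mul_nonneg (by exact_mod_cast hs j hj) (mul_nonneg (pow_nonneg zero_le_two _) (hsh j hjn))
    linarith
  have hK' : (1 : ℝ) ≤ (K : ℝ) ^ 2 := by
    have : (1 : ℝ) ≤ K := by exact_mod_cast hK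
    nlinarith
  have hu' : (0 : ℝ) < c.u := by exact_mod_cast hu
  nlinarith

/-- **Certified LP upper bound for PURE quantum codes, conditional on Rains's Theorem 10 (pure form)**: granted the
named fact `Rains1999_LPBound_pure`, a certificate passing `checkPure` shows that no PURE `((n,K,d))` exists (in
particular, with `K = 1`: no pure `((n,1,d))`, Rains's reading of the `k = 0` column — self-dual additive codes and
their non-additive analogues). Column: proved (ours), CONDITIONAL.
[cite: Rains1999Shadow, Thm. 10 with the Remark after it, and Thm. 14 (pure ((n,1,d)))] -/
theorem no_pureCodeProjection_of_checkPure (hLP : Rains1999_LPBound_pure) (c : RainsCert) (hK : 1 ≤ K)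
    (h : c.checkPure n K d = true) (P : Matrix (Fin n → Bool) (Fin n → Bool) ℂ) (hP : IsCodeProjection P K d)
    (hpure : IsPureToWeight P d) : False :=
  not_rainsLPFeasiblePure_of_checkPure c hK h (hLP n K d P hP hpure)

end SoundnessPure

/-! ### A worked pure instance: no pure `((6,1,5))` — the hexacode state `((6,1,4))` is LP-extremal -/

/-- Certificate for the pure system at `(n,K,d) = (6,1,5)` (exact rational simplex; `farkas_rains.py … pure`).
Column: data (ours). [cite: Rains1999Shadow, Thm. 14 (pure ((6m+l,1,d)): m = 1, l = 0 gives d ≤ 4)] -/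
def rcert_6_1_5_pure : RainsCert :=
  ⟨1, [(1/48), (1/144), (1/720), 0, 0, 0, 0], [0, 0, 0, 0, 0, 0, 0]⟩

/-- The certificate passes the pure check (kernel evaluation). [cite: Rains1999Shadow, Thm. 14] -/
theorem checkPure_rcert_6_1_5 : rcert_6_1_5_pure.checkPure 6 1 5 = true := by
  decide +kernel

/-- **Rains's pure system is infeasible at `(n,K,d) = (6,1,5)`** — unconditional, kernel-checked (feasible at
`(6,1,4)`: the hexacode / `[[6,0,4]]`). Column: proved (ours). [cite: Rains1999Shadow, Thm. 10 (Remark) and Thm. 14] -/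
theorem not_rainsLPFeasiblePure_6_1_5 : ¬ RainsLPFeasiblePure 6 1 5 :=
  not_rainsLPFeasiblePure_of_checkPure _ le_rfl checkPure_rcert_6_1_5

/-- **No pure `((6,1,5))` of any kind — CONDITIONAL on Rains's Theorem 10 (pure form)** (named fact
`Rains1999_LPBound_pure`). Column: proved (ours), conditional. [cite: Rains1999Shadow, Thm. 10 (Remark) and Thm. 14] -/
theorem no_pureCode_6_1_5 (hLP : Rains1999_LPBound_pure) (P : Matrix (Fin 6 → Bool) (Fin 6 → Bool) ℂ)
    (hP : IsCodeProjection P 1 5) (hpure : IsPureToWeight P 5) : False :=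
  no_pureCodeProjection_of_checkPure hLP _ le_rfl checkPure_rcert_6_1_5 P hP hpure

end Summit.Ventures.QEC.Census
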